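import Summits.PneNP.PneNP.Theorems.PstarSAConsistency
import Summits.PneNP.PneNP.Theorems.PstarSAClosure
import Summits.PneNP.PneNP.Theorems.PstarSAAssembly

/-!
# T21.1 — linear-level Sherali–Adams feasibility of every fibre of an expanding typed `P⋆` map (the leaf)

FRONTIER range-avoidance ladder, rung F-N3 context (restricted-model lower bound for the Sherali–Adams hierarchy on typed
`P⋆`; cell `pnp-ideate`, ROUND-21 item T21.1 — nothing here bears on `P` vs `NP`).

`typedSALinearLevel : PstarSALevel.TypedSALinearLevel` with the constant `c = 28`: on every typed pure-`P⋆` instance whose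
output hypergraph is `(r, 3/2)`-boundary expanding, the fibre `I(x) = y` of EVERY target `y` is Sherali–Adams feasible at
level `r / 28` (simple overlaps are not even needed).  Assembly BY NAME of the cell's three suppliers, following
Benabbas–Georgiou–Magen–Tulsiani 2012 §§3–4 with balance replaced by type-consistent biases:

* closure `cl S` = the advice set of `PstarSAClosure.exists_closure` (prover-1; `|cl S| ≤ 17|S|`, and `G|−cl S` is
  `5/4`-expanding on non-dominated families within budget `r − 4|S|`);
* laws `P := PstarSAPeeling.law I y` with Lemma 3.2 `h32 := law_consistent`, `htotal := law_total`, support and sign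
  (`PstarSAPeeling`, `PstarSAPeelStep`, `PstarSAConsistency`);
* glue `PstarSAAssembly.saFeasible_of_closure` (prover-1; BGMT Lemma 2.3 through the common refinement `cl S ∪ cl T`);

plus the size arithmetic: with `t = r/28` and `B = 34t ≥ 2|cl S|`, a set `S'` of `≤ B` variables dominates at most
`2B/3 < r − 4t` outputs (`card_dom_le`, from expansion: a dominated family has its boundary inside `S'`).
-/

set_option linter.dupNamespace false

open Finset Literature.Computability.Complexity
open Summit.PneNP.PneNP.Theorems.PstarSALevel (varSet cyl bdry BoundaryExpanding SAFeasible TypedSALinearLevel)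
open Summit.PneNP.PneNP.Theorems.PstarSAPeeling
open Summit.PneNP.PneNP.Theorems.PstarSAClosure (exists_closure)
open Summit.PneNP.PneNP.Theorems.PstarSAAssembly (saFeasible_of_closure)

namespace Summit.PneNP.PneNP.Theorems.PstarTypedSALinearLevel

variable {n m : ℕ}

/-- The boundary of a family of outputs dominated by `S'` lies inside `S'`. -/
theorem bdry_subset_of_subset_dom {I : LocalMap 4 n m} {S' : Finset (Fin n)} {J : Finset (Fin m)} (hJ : J ⊆ dom I S') :
    bdry I J ⊆ S' := by
  intro v hv
  obtain ⟨j, hj, hvj⟩ := mem_bdry_iff.1 hv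
  exact mem_dom.1 (hJ hj) (priv_subset I J j hvj)

/-- Under `(r, 3/2)`-boundary expansion a dominated family of at most `r` outputs is small: `3·#J ≤ 2·#S'`. -/
theorem three_card_le {r : ℕ} {I : LocalMap 4 n m} (hB : BoundaryExpanding r I) {S' : Finset (Fin n)} {J : Finset (Fin m)}
    (hJ : J ⊆ dom I S') (hr : J.card ≤ r) : 3 * J.card ≤ 2 * S'.card :=
  (hB J hr).trans (Nat.mul_le_mul_left 2 (card_le_card (bdry_subset_of_subset_dom hJ)))

/-- **Dominated families are small**: if `2·#S' < 3r` then `#dom S' ≤ r` and `3·#dom S' ≤ 2·#S'`. -/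
theorem card_dom_le {r : ℕ} {I : LocalMap 4 n m} (hB : BoundaryExpanding r I) {S' : Finset (Fin n)}
    (h : 2 * S'.card < 3 * r) : (dom I S').card ≤ r ∧ 3 * (dom I S').card ≤ 2 * S'.card := by
  have h1 : (dom I S').card ≤ r := by
    by_contra hlt
    push Not at hlt
    obtain ⟨J, hJ, hJc⟩ := exists_subset_card_eq hlt.le
    have := three_card_le hB hJ hJc.le
    omega
  exact ⟨h1, three_card_le hB Subset.rfl h1⟩

/-- Nothing non-empty is strictly expanding inside the empty family (the degenerate budget `r = 0`). -/
theorem strictExpandingOff_empty (I : LocalMap 4 n m) (T : Finset (Fin n)) : StrictExpandingOff I T ∅ :=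
  fun J hJ hne => absurd hne (by rw [subset_empty.1 hJ]; exact not_nonempty_empty)

/-- **T21.1 — LINEAR-LEVEL SHERALI–ADAMS FEASIBILITY FOR TYPED `P⋆` (every target).**  With `c = 28`: on a typed pure-`P⋆`
instance that is `(r, 3/2)`-boundary expanding (simple overlaps unused), the fibre of every `y ∈ {0,1}^m` is Sherali–Adams
feasible at level `r / 28` — no level-`r/28` Sherali–Adams refutation of "`y ∈ Range(I)`" exists, whatever `y`.  The laws
are `S ↦ law I y (cl S)` (BGMT's `P_µ(S̄)` with the junction-tree reweighting; `cl` = `PstarSAClosure.exists_closure`),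
assembled by `PstarSAAssembly.saFeasible_of_closure` from `law_consistent` / `law_total` / `law_support`.  Restricted-model
lower bound for a relaxation hierarchy (cell pnp-ideate, ROUND-21); it says nothing about `P` versus `NP`. -/
theorem typedSALinearLevel : TypedSALinearLevel := by
  refine ⟨28, by norm_num, fun n m r I hI hT hB _ y => ?_⟩
  classical
  set t : ℕ := r / 28 with ht
  choose cl hsub hcard hclosed using fun S : Finset (Fin n) => exists_closure I r hB S
  let Closed : Finset (Fin n) → Prop := fun S₁ => ∀ M : Finset (Fin m), M.Nonempty → (∀ j ∈ M, ¬ varSet I j ⊆ S₁) →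
    M.card + 4 * t ≤ r → 5 * M.card ≤ 4 * (bdry I M \ S₁).card
  refine saFeasible_of_closure I y t (34 * t) Closed cl (law I y) hsub ?_ ?_ (fun S x => law_nonneg I y S x) ?_
    (fun S j x hj hx => law_support hI y hj hx) ?_
  · -- closures are closed
    intro S hS M hM hnd hbud
    exact hclosed S M hM hnd (by omega)
  · -- closures are small
    intro S hS
    have := hcard S
    omega
  · -- normalisation within budget
    intro S' hS'
    rcases Nat.eq_zero_or_pos r with hr0 | hr
    · have hS0 : S' = ∅ := card_eq_zero.1 (by omega)
      subst hS0
      refine law_total hI hT y ?_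
      rw [dom_empty]
      exact strictExpandingOff_empty I ∅
    · have hlt : 2 * S'.card < 3 * r := by omega
      exact law_total_of_boundaryExpanding hI hT hB y (card_dom_le hB hlt).1
  · -- Lemma 3.2 on closed sets within budget
    intro S₁ S₂ hC h12 hS₂ a
    refine law_consistent hI hT y h12 ?_ a
    rcases Nat.eq_zero_or_pos r with hr0 | hr
    · have hS0 : S₂ = ∅ := card_eq_zero.1 (by omega)
      subst hS0
      rw [dom_empty, empty_sdiff]
      exact strictExpandingOff_empty I S₁
    · intro J hJ hne
      have hlt : 2 * S₂.card < 3 * r := by omega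
      obtain ⟨-, hdom3⟩ := card_dom_le hB hlt
      have hJc : J.card ≤ (dom I S₂).card := card_le_card (hJ.trans sdiff_subset)
      have hnd : ∀ j ∈ J, ¬ varSet I j ⊆ S₁ := fun j hj h => (mem_sdiff.1 (hJ hj)).2 (mem_dom.2 h)
      have h5 := hC J hne hnd (by omega)
      have hpos := hne.card_pos
      omega

end Summit.PneNP.PneNP.Theorems.PstarTypedSALinearLevel
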